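/-
Origin: expansion seat `planner-pub-hodgecm-1-g66-0`, handover #D2 2026-08-20T13:48Z md5 6a08fed1932a (PKG 320e8f9d33f6 → 6a08fed1932a; 374 l.; DOC-ONLY: module docstring l.54 «Standing:» rider → the (S6) standing sentence; NAME LIST: none) (`HOME/pub-hodgecm-1-g66/lean/doc52/HodgeCM/StubTree/SignMatchArch.lean`, md5 6a08fed1932a, 374 lines);
landed by the second packager p2 gen 8 (p2-g8) in gate run 52 REPLACES the earlier landed copy of `HodgeCM/StubTree/SignMatchArch.lean` (seat copy carried the packager Origin header of an earlier run (stripped)).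
-/
/-
Origin: planner-pub-hodgecm-prl2-g8-0 (unit pub-hodgecm-prl2-g8; EXPANSION prover a-2 "REDUCE, don't construct", generation 8).
Target: HodgeCM/StubTree/SignMatchArch.lean (NEW additive leaf over this generation's `HodgeCM.StubTree.TypeMatchByName` and the
cited-fact seat's `HodgeCM.Literature.ArchThetaSignature` (cf-kudla-howe-rallis-g7, RUN 31 CLAIM #2 14:59:19Z, md5 ab583558…, shipped on the
request "prl2 imports ArchThetaSignature", STATUS 14:57:09Z); nothing landed or queued is replaced).
WIP imports `Prl2g8.TypeMatchByName` ↦ `HodgeCM.StubTree.TypeMatchByName`, `CfKHRg7.ArchThetaSignature` ↦ `HodgeCM.Literature.ArchThetaSignature`.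
-/
import Summits.HodgeConjecture.HodgeCM.StubTree.TypeMatchByName
import Summits.HodgeConjecture.HodgeCM.Literature.ArchThetaSignature

/-!
# Sign match at the distinguished place: (X4a-ii) split, and its `ι₁`-half BY NAME of [BMM16] p. 66 / [Paul98]

Generation 8, file 3 (strategy 2 "REDUCE, don't construct").  Generation 7 typed THE OBSTRUCTION (X4a) as
`SignForcing ⇐ TypeMatch ∧ SignMatch`; file 1 of this generation made (X4a-i) `TypeMatch` a kernel theorem.  This
file splits the remaining P-IF conjunct (X4a-ii) `BMMDict.SignMatch T` by PLACE,
`SignMatch ⇐ SignMatchDist ∧ SignMatchAway` (`signMatch_of_dist_away`), where `SignMatchDist` is the clause at the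
two embeddings `ι₁, ῑ₁` over the distinguished real place `v₁` of `L₀` (`U(V)(L₀,v₁) ≅ U(2,1)`) and `SignMatchAway`
the clause at the other (compact) places, and DERIVES the distinguished half:

* KERNEL, no print (`signMatchDist_of_uniform`): under file 1's P-IF reading `LineAlbanese` and M13 `Fact_alphaLine`,
  EVERY type `Φ` carrying a non-zero line theta class CONTAINS `ι₁` (`mem_type_of_lineTheta`: the class lies in
  `U_{(N,Ψ',ι₁∘k)}(Γ) ≠ ⊥`, so `ι₁ ∘ k ∈ Ψ'` by prl2-g3's `Universe.Uiso_eq_bot_of_not_mem`, i.e. `ι₁ ∈ Φ_k(Ψ') = Φ`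
  by `CMTypeOps.comp_mem_reflexInflateSet_iff` at `g = 1`).  Hence `SignMatchDist` is EQUIVALENT (given the frame
  sign's conjugation law `Design_frameSignConj`) to the UNIFORM-SIGN statement `UniformSignDist`: every line `⟨a⟩`
  carrying a non-zero holomorphic theta class has `decide (0 < Re ι₁(a)) = T.frameSign L ι₁ ι₁`.
* PRINT + one READING + one DESIGN seam (`uniformSignDist_of_arch`): `UniformSignDist` follows from
  - PRINT BY NAME: `HodgeCM.Literature.BMM.BMMArchSpectrum.ArchSignature` (cited-fact seat cf-kudla-howe-rallis-g7) =
    [BMM16] N. Bergeron, J. Millson, C. Moeglin, *The Hodge conjecture and arithmetic quotients of complex balls*, Acta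
    Math. 216 (2016), end of the proof of Thm 7.2, printed p. 66 (= arXiv:1306.1515v3 proof of Thm 7.8, held chunk
    p0034 L40 of `paper:arxiv-1306.1515`): "the cohomological representation `A(b×q, a×q)` is the image of the local
    theta correspondence from a group `U(W, ℂ/ℝ)` with `dim W = a+b` if and only if the signature of `W` is `(a,b)`"
    (after A. Paul, J. Funct. Anal. 159 (1998));
  - P-IF READING `ArchLineDatum.Reading` (labelled, never citable): the archimedean component at `v₁` of the
    automorphic representation generated by a non-zero class of `BD.lineTheta Γ a Φ` is the holomorphic-one-form
    representation `A(b×q, a×q)` of the datum's bidegree (`BD.Standard.h10_le`) and IS the image of the local theta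
    correspondence from `U(⟨a⟩ ⊗_{L₀} L₀,v₁)`, whose signature is `sigAt ι₁ a = (1,0)` if `ι₁(a) > 0` and `(0,1)`
    otherwise (compatibility of the global theta lift with the local Howe correspondence at `v₁`);
  - DESIGN seam `FrameBidegree`: `T.frameSign L ι₁ ι₁ = decide (BD.a = 1)` — the frame sign at `ι₁` NAMES the bidegree
    convention (for strategy 1's recipe `SignRecipe.frameSign_self : frameSign L ι₁ ι₁ = true`, this is [BMM16]'s
    `(a,b) = (1,0)`, as that lemma's docstring records).
THE OBSTRUCTION OF RECORD thereby shrinks to the compact-place half `SignMatchAway` (Howe duality for the compact pair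
`(U(1), U(3))`: Kashiwara–Vergne 1978 / J. Adams 2007 Prop. 6.6, typed as `UpUmnTheta.Adams_Prop_6_6`, + the
block-character weight dictionary — untyped; GAPS prl2g8-O1 narrowed to prl2g8-O2).

CLASSIFICATION LEDGER (binding rule of the unit: no internally-minted statement enters as a cited fact).
PRINT: `BMMArchSpectrum.ArchSignature` (cf-KHR-g7, verbatim [BMM16] p. 66).  P-IF: `ArchLineDatum.Reading`,
`SignMatchAway` (the untyped remainder of X4a-ii), file 1's `LineAlbanese`.  MODEL: M13 `Fact_alphaLine`, `UisoRigid`.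
DESIGN: `FrameBidegree`, `Design_frameSignConj`, `T.kappa = SignRecipe.kappa false`.  KERNEL: everything proved here.
Standing: PerL, QW8, N33 and every 2001-programme claim remain NOT cited; printed PerL v5 stands UNREFUTED and UNPROVED (GAPS.md «PROVENANCE ANSWER (coordinator, 2026-08-20)», (S6)) independently.
-/

set_option autoImplicit false

noncomputable section

open NumberField

namespace HodgeCM

open Literature.AlgebraicGeometry.Motives (CMType)
open CMTypeOps (inflate reflexInflateSet)
open HodgeCM.Literature.BMM (BMMSpectrum BMMArchSpectrum)

namespace Universe

variable {U : Universe}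

namespace BMMDict

variable {L : CMField} {ι₁ : L →+* ℂ} {V : HermSpace3 L ι₁} (BD : U.BMMDict V)

/-! ## (A) The place split of (X4a-ii) -/

/-- The (X4a-ii) clause at one complex embedding `τ`: the sign of `a` at `τ` is the frame sign if `τ ∈ Φ` and the
opposite sign if `τ ∉ Φ`. -/
def signClause (T : U.ThetaModel) (a : L) (Φ : CMType L) (τ : L →+* ℂ) : Prop :=
  (if ind Φ τ = 1 then T.frameSign L ι₁ τ else !(T.frameSign L ι₁ τ)) = decide (0 < (τ a).re)

/-- (X4a-ii) `SignMatch` is the sign clause at every embedding (definitional unfolding). -/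
theorem signMatch_iff (T : U.ThetaModel) : BD.SignMatch T ↔
    ∀ (Γ : Level V) (a : L) (Φ : CMType L) (θ : U.CohC (U.pms L ι₁ V Γ) 1), θ ∈ BD.lineTheta Γ a Φ → θ ≠ 0 →
      ∀ τ : L →+* ℂ, signClause (ι₁ := ι₁) T a Φ τ :=
  Iff.rfl

/-- **(X4a-ii, distinguished half) P-IF** — the sign clause at the two embeddings `ι₁`, `ῑ₁` over the distinguished
real place `v₁` (`U(V)(L₀,v₁) ≅ U(2,1)`).  DERIVED below from [BMM16] p. 66 + one reading + one design seam. -/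
def SignMatchDist (T : U.ThetaModel) : Prop :=
  ∀ (Γ : Level V) (a : L) (Φ : CMType L) (θ : U.CohC (U.pms L ι₁ V Γ) 1), θ ∈ BD.lineTheta Γ a Φ → θ ≠ 0 →
    ∀ τ : L →+* ℂ, (τ = ι₁ ∨ τ = ComplexEmbedding.conjugate ι₁) → signClause (ι₁ := ι₁) T a Φ τ

/-- **(X4a-ii, compact half) P-IF — THE REMAINING OBSTRUCTION**: the sign clause at the embeddings over the COMPACT
places (`U(V)(L₀,v) ≅ U(3)`).  PRINT behind it: Howe duality for the compact dual pair `(U(1), U(3))` in the Fock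
model (Kashiwara–Vergne, Invent. Math. 44 (1978); J. Adams, *The theta correspondence over ℝ* (2007) Prop. 6.6, typed
verbatim as `HodgeCM.Literature.UpUmnTheta.Adams_Prop_6_6`: the trivial `U(3)`-type is the lift of the VACUUM
character `±3/2` of `U(1)~`, the sign being that of the line) and the weight dictionary "block type at `v` ↔
archimedean weight of the lifted character at `v`" — the seam is NOT typed (GAPS prl2g8-O2).  Class: P-IF. -/
def SignMatchAway (T : U.ThetaModel) : Prop :=
  ∀ (Γ : Level V) (a : L) (Φ : CMType L) (θ : U.CohC (U.pms L ι₁ V Γ) 1), θ ∈ BD.lineTheta Γ a Φ → θ ≠ 0 →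
    ∀ τ : L →+* ℂ, τ ≠ ι₁ → τ ≠ ComplexEmbedding.conjugate ι₁ → signClause (ι₁ := ι₁) T a Φ τ

/-- KERNEL: (X4a-ii) is the conjunction of its two halves. -/
theorem signMatch_of_dist_away {T : U.ThetaModel} (hD : BD.SignMatchDist T) (hA : BD.SignMatchAway T) :
    BD.SignMatch T := by
  intro Γ a Φ θ hθ hne τ
  by_cases h₁ : τ = ι₁
  · exact hD Γ a Φ θ hθ hne τ (Or.inl h₁)
  · by_cases h₂ : τ = ComplexEmbedding.conjugate ι₁
    · exact hD Γ a Φ θ hθ hne τ (Or.inr h₂)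
    · exact hA Γ a Φ θ hθ hne τ h₁ h₂

/-- KERNEL: conversely each half is a restriction of (X4a-ii). -/
theorem signMatchDist_of_signMatch {T : U.ThetaModel} (h : BD.SignMatch T) : BD.SignMatchDist T :=
  fun Γ a Φ θ hθ hne τ _ => h Γ a Φ θ hθ hne τ

/-- KERNEL: the compact half is a restriction of (X4a-ii). -/
theorem signMatchAway_of_signMatch {T : U.ThetaModel} (h : BD.SignMatch T) : BD.SignMatchAway T :=
  fun Γ a Φ θ hθ hne τ _ _ => h Γ a Φ θ hθ hne τ

/-! ## (B) KERNEL — every type carrying a line theta class contains `ι₁`; the distinguished half is a uniform sign -/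

/-- **KERNEL**: under the Albanese dictionary for lines (P-IF `LineAlbanese`) and M13, the `L`-type `Φ` of a non-zero
line theta one-form class contains the distinguished embedding `ι₁`: the class lies in `U_{(N,Ψ',ι₁∘k)}(Γ)`, which
is `⊥` unless `ι₁ ∘ k ∈ Ψ'` (`Universe.Uiso_eq_bot_of_not_mem`), and `ι₁ ∈ Φ_k(Ψ') ⟺ ι₁ ∘ k ∈ Ψ'`
(`CMTypeOps.comp_mem_reflexInflateSet_iff` at `g = 1`). -/
theorem mem_type_of_lineTheta (h13 : U.Fact_alphaLine) (hA : BD.LineAlbanese) {Γ : Level V} {a : L}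
    {Φ : CMType L} {θ : U.CohC (U.pms L ι₁ V Γ) 1} (hθ : θ ∈ BD.lineTheta Γ a Φ) (hne : θ ≠ 0) : ι₁ ∈ Φ.1 := by
  obtain ⟨N, k, Ψ', hΦ, hU⟩ := hA Γ a Φ θ hθ hne
  have hk : ι₁.comp k ∈ Ψ'.1 := by
    by_contra hk
    have hbot := U.Uiso_eq_bot_of_not_mem h13 Γ hk
    rw [hbot, Submodule.mem_bot] at hU
    exact hne hU
  have hmem : ι₁.comp (RingEquiv.refl L).toRingHom ∈ reflexInflateSet k ι₁ Ψ' :=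
    (CMTypeOps.comp_mem_reflexInflateSet_iff k ι₁ Ψ' (RingEquiv.refl L)).mpr (by simpa using hk)
  rw [hΦ]
  simpa using hmem

/-- **The uniform sign at the distinguished place** (P-IF ∘ DESIGN; DERIVED from print below): every hermitian line
`⟨a⟩` carrying a non-zero holomorphic theta one-form class has, at `ι₁`, the frame sign `T.frameSign L ι₁ ι₁`. -/
def UniformSignDist (T : U.ThetaModel) : Prop :=
  ∀ (Γ : Level V) (a : L) (Φ : CMType L) (θ : U.CohC (U.pms L ι₁ V Γ) 1), θ ∈ BD.lineTheta Γ a Φ → θ ≠ 0 →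
    T.frameSign L ι₁ ι₁ = decide (0 < (ι₁ a).re)

/-- **KERNEL**: the distinguished half of (X4a-ii) from the uniform sign, the Albanese dictionary for lines, M13 and
the conjugation law of the frame sign.  At `τ = ι₁`: `ι₁ ∈ Φ` (`mem_type_of_lineTheta`), so the clause reads
`frameSign ι₁ = sign`; at `τ = ῑ₁ ∉ Φ`: `!frameSign ῑ₁ = !!frameSign ι₁` and `Re ῑ₁(a) = Re ι₁(a)`. -/
theorem signMatchDist_of_uniform {T : U.ThetaModel} (h13 : U.Fact_alphaLine) (hA : BD.LineAlbanese)
    (hs : T.Design_frameSignConj) (hu : BD.UniformSignDist T) : BD.SignMatchDist T := by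
  intro Γ a Φ θ hθ hne τ hτ
  have hι : ι₁ ∈ Φ.1 := BD.mem_type_of_lineTheta h13 hA hθ hne
  have hsgn := hu Γ a Φ θ hθ hne
  unfold signClause
  rcases hτ with rfl | rfl
  · rw [if_pos ((ind_eq_one_iff_mem Φ _).mpr hι)]
    exact hsgn
  · have hnot : ComplexEmbedding.conjugate ι₁ ∉ Φ.1 := fun h => ((Φ.2 ι₁).mp hι) h
    rw [if_neg (fun h => hnot ((ind_eq_one_iff_mem Φ _).mp h)), hs L ι₁ ι₁, Bool.not_not, hsgn,
      ComplexEmbedding.conjugate_coe_eq, Complex.conj_re]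

/-! ## (C) The `ι₁`-half BY NAME of [BMM16] p. 66 (cf-KHR's `ArchSignature`) -/

/-- The signature at `v₁` of the hermitian line `(L, a x ȳ)`: `(1,0)` if `ι₁(a) > 0`, else `(0,1)`. -/
def sigAt (ι : L →+* ℂ) (a : L) : ℕ × ℕ := if 0 < (ι a).re then (1, 0) else (0, 1)

/-- The line signature has total dimension `1`. -/
theorem sigAt_fst_add_snd (ι : L →+* ℂ) (a : L) : (sigAt ι a).1 + (sigAt ι a).2 = 1 := by
  unfold sigAt; split_ifs <;> rfl

/-- **P-IF DATUM — the local archimedean theta predicate at `v₁`** on the dictionary's spectra: `IsLoc Γ π_∞ (a',b')`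
= "`π_∞ ∈ Coh_∞` of `BD.X Γ` is the image of the local theta correspondence from a group `U(W, ℂ/ℝ)`, `W` of signature
`(a',b')`" — the cited-fact seat's carrier `BMMArchSpectrum.IsLocalThetaLiftFrom`, attached to `BD.X Γ`. -/
structure ArchLineDatum where
  /-- `π_∞` is the image of the local theta correspondence at `v₁` from `U(W, ℂ/ℝ)`, `W` of signature `(a',b')` -/
  IsLoc : (Γ : Level V) → (BD.X Γ).CohInf → ℕ × ℕ → Prop

namespace ArchLineDatum

variable {BD} (AD : BD.ArchLineDatum)

/-- The dictionary's spectrum at `Γ` with the local predicate: a `BMMArchSpectrum` of the cited-fact seat. -/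
def spectrum (Γ : Level V) : BMMArchSpectrum :=
  { toBMMSpectrum := BD.X Γ, IsLocalThetaLiftFrom := AD.IsLoc Γ }

/-- **P-IF READING (labelled; never citable as a fact)**: the archimedean component at `v₁` of the automorphic
representation generated by (the fine-level realisation of) a non-zero class of `BD.lineTheta Γ a Φ` is the
holomorphic-one-form representation `A(b×q, a×q)` of the datum's bidegree `(BD.a, BD.b)` (`BD.Standard.h10_le`), and
it IS the image of the local theta correspondence at `v₁` from `U(⟨a⟩ ⊗ L₀,v₁)`, a group `U(W, ℂ/ℝ)` with `W` of
signature `sigAt ι₁ a` (compatibility of the global theta lift from the line with the local Howe correspondence at the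
distinguished place; [BMM16] §7.7 / Def 7.5 for the global notion, [Paul98] for the local one).  CONVENTION EXPOSURE
(labelled, never cited): [BMM16]'s hermitianisation of the skew-Hermitian `W` (Remark after §7.1) is read so that the
line `(L, a x ȳ)` with `ι₁(a) > 0` has signature `(1,0)` at `v₁`; the opposite reading swaps `sigAt` here AND the seam
`FrameBidegree` (to `BD.b = 1`) — the derived `UniformSignDist` is the same either way. -/
def Reading : Prop :=
  ∀ (Γ : Level V) (a : L) (Φ : CMType L) (θ : U.CohC (U.pms L ι₁ V Γ) 1), θ ∈ BD.lineTheta Γ a Φ → θ ≠ 0 →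
    AD.IsLoc Γ ((BD.X Γ).A BD.b BD.a) (sigAt ι₁ a)

end ArchLineDatum

/-- **DESIGN seam — the frame sign at `ι₁` names the bidegree convention**: `T.frameSign L ι₁ ι₁ = ⊤` iff the
datum's bidegree is `(a,b) = (1,0)`, i.e. iff holomorphic one-forms are theta lifts from POSITIVE lines at `v₁`
(for strategy 1's recipe, `SignRecipe.frameSign_self`, this is [BMM16] Cor 7.9's `(a,b) = (1,0)`).  It PINS NOTHING
NEW: given the print fact and the reading it is EQUIVALENT to `UniformSignDist` as soon as one line carries a
non-zero class (`uniformSignDist_of_arch` / `frameBidegree_of_uniform`), i.e. to the `ι₁`-clause of generation 7's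
standing (X4a-ii). -/
def FrameBidegree (T : U.ThetaModel) : Prop :=
  T.frameSign L ι₁ ι₁ = decide (BD.a = 1)

/-- KERNEL: print ([BMM16] p. 66) + reading force the `v₁`-signature of every line carrying a non-zero holomorphic
theta class to be the datum's bidegree `(BD.a, BD.b)`. -/
theorem sigAt_eq_of_arch {T : U.ThetaModel} (hBD : BD.Standard T) (AD : BD.ArchLineDatum)
    (hP : ∀ Γ, (AD.spectrum Γ).ArchSignature) (hR : AD.Reading) {Γ : Level V} {a : L} {Φ : CMType L}
    {θ : U.CohC (U.pms L ι₁ V Γ) 1} (hθ : θ ∈ BD.lineTheta Γ a Φ) (hne : θ ≠ 0) : sigAt ι₁ a = (BD.a, BD.b) := by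
  have hdeg : (BD.X Γ).degreeBound BD.a BD.b :=
    (BD.X Γ).degreeBound_of_add_eq_one hBD.hab (by rw [hBD.m_eq Γ])
  exact (hP Γ BD.a BD.b (sigAt ι₁ a).1 (sigAt ι₁ a).2 hdeg (by rw [sigAt_fst_add_snd, hBD.hab])).mp
    (hR Γ a Φ θ hθ hne)

omit BD in
/-- KERNEL (arithmetic of the seam): if the `v₁`-signature of the line `⟨a⟩` is `(a', b')` with `a' + b' = 1`, then
`ι₁(a) > 0 ⟺ a' = 1`. -/
theorem decide_pos_eq_of_sigAt {a : L} {a' b' : ℕ} (h : sigAt ι₁ a = (a', b')) :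
    decide (0 < (ι₁ a).re) = decide (a' = 1) := by
  unfold sigAt at h
  by_cases hp : 0 < (ι₁ a).re
  · rw [if_pos hp] at h
    rw [decide_eq_true hp, ← (Prod.mk.inj h).1, decide_eq_true rfl]
  · rw [if_neg hp] at h
    rw [decide_eq_false hp, ← (Prod.mk.inj h).1, decide_eq_false (by decide : ¬ (0 : ℕ) = 1)]

/-- **The `ι₁`-half BY NAME**: `UniformSignDist` from [BMM16] p. 66 (`BMMArchSpectrum.ArchSignature` of the
cited-fact seat, for the spectra of the datum), the reading `ArchLineDatum.Reading`, the design seam `FrameBidegree`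
and the dictionary seams `m = 3`, `a + b = 1` (`BD.Standard`).  Proof: the reading makes `A(b×q,a×q)` a local theta
lift from signature `sigAt ι₁ a`; the printed "iff" forces `sigAt ι₁ a = (BD.a, BD.b)`; so `ι₁(a) > 0 ⟺ BD.a = 1
⟺ frameSign ι₁`. -/
theorem uniformSignDist_of_arch {T : U.ThetaModel} (hBD : BD.Standard T) (AD : BD.ArchLineDatum)
    (hP : ∀ Γ, (AD.spectrum Γ).ArchSignature) (hR : AD.Reading) (hF : BD.FrameBidegree T) :
    BD.UniformSignDist T := by
  intro Γ a Φ θ hθ hne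
  rw [hF, decide_pos_eq_of_sigAt (BD.sigAt_eq_of_arch hBD AD hP hR hθ hne)]

/-- KERNEL (converse — the seam pins nothing new): the uniform sign, print and reading give back `FrameBidegree` as
soon as ONE line carries a non-zero holomorphic theta class. -/
theorem frameBidegree_of_uniform {T : U.ThetaModel} (hBD : BD.Standard T) (AD : BD.ArchLineDatum)
    (hP : ∀ Γ, (AD.spectrum Γ).ArchSignature) (hR : AD.Reading) (hu : BD.UniformSignDist T)
    (hex : ∃ (Γ : Level V) (a : L) (Φ : CMType L) (θ : U.CohC (U.pms L ι₁ V Γ) 1), θ ∈ BD.lineTheta Γ a Φ ∧ θ ≠ 0) :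
    BD.FrameBidegree T := by
  obtain ⟨Γ, a, Φ, θ, hθ, hne⟩ := hex
  rw [FrameBidegree, hu Γ a Φ θ hθ hne, decide_pos_eq_of_sigAt (BD.sigAt_eq_of_arch hBD AD hP hR hθ hne)]

/-- **(X4a-ii) from its printed `ι₁`-half and the compact-place remainder.** -/
theorem signMatch_of_arch {T : U.ThetaModel} (h13 : U.Fact_alphaLine) (hBD : BD.Standard T)
    (hA : BD.LineAlbanese) (hs : T.Design_frameSignConj) (AD : BD.ArchLineDatum)
    (hP : ∀ Γ, (AD.spectrum Γ).ArchSignature) (hR : AD.Reading) (hF : BD.FrameBidegree T)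
    (hAway : BD.SignMatchAway T) : BD.SignMatch T :=
  BD.signMatch_of_dist_away
    (BD.signMatchDist_of_uniform h13 hA hs (BD.uniformSignDist_of_arch hBD AD hP hR hF)) hAway

end BMMDict

/-! ## (D) The by-name package with the `ι₁`-half discharged, and the end states -/

/-- **The BMM–glue package BY NAME, archimedean form, faces**: file 1's `BMMByNameFace T` with (X4a-ii) `SignMatch`
replaced by its compact-place half `SignMatchAway` (P-IF, THE remaining obstruction), the PRINT fact
`ArchSignature` ([BMM16] p. 66, BY NAME, for the spectra of an archimedean datum `AD`), the P-IF reading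
`AD.Reading` and the DESIGN seam `FrameBidegree`. -/
def BMMByNameArchFace (T : U.ThetaModel) : Prop :=
  ∀ (F : CMField), IsGalois ℚ F → 6 ≤ Module.finrank ℚ F →
    ∀ (f : Face F) (ι₁ : F →+* ℂ), f.Admissible ι₁ → ∀ V : HermSpace3 F ι₁,
      U.UisoDisjoint V ∧ U.UisoRigid V ∧ ∃ BD : U.BMMDict V, BD.Standard T ∧ (∀ Γ, (BD.X Γ).Cor79) ∧
        BD.Homogeneous ∧ BD.LineAlbanese ∧ BD.ThetaOfLine T ∧ BD.LineOfTheta T ∧ BD.SignMatchAway T ∧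
        BD.FrameBidegree T ∧ ∃ AD : BD.ArchLineDatum, (∀ Γ, (AD.spectrum Γ).ArchSignature) ∧ AD.Reading

/-- The same under the PerL binders. -/
def BMMByNameArchPerL (T : U.ThetaModel) : Prop :=
  ∀ (K L : CMField) (j : K →+* L), IsNormalClosure ℚ K L →
    Module.finrank ℚ K = 6 → (Module.finrank ℚ L = 24 ∨ Module.finrank ℚ L = 48) →
    ∀ (φ : Fin 3 → (K →+* ℂ)), IsFrame φ →
    ∀ (ι₁ : L →+* ℂ), ι₁.comp j = φ 0 →
    ∀ (t : Fin 4 → CMType K), IsPerLTypes φ t →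
    ∀ V : HermSpace3 L ι₁,
      U.UisoDisjoint V ∧ U.UisoRigid V ∧ ∃ BD : U.BMMDict V, BD.Standard T ∧ (∀ Γ, (BD.X Γ).Cor79) ∧
        BD.Homogeneous ∧ BD.LineAlbanese ∧ BD.ThetaOfLine T ∧ BD.LineOfTheta T ∧ BD.SignMatchAway T ∧
        BD.FrameBidegree T ∧ ∃ AD : BD.ArchLineDatum, (∀ Γ, (AD.spectrum Γ).ArchSignature) ∧ AD.Reading

namespace ThetaModel

variable {T : U.ThetaModel}

/-- KERNEL: the archimedean package implies file 1's by-name package (faces), given M13 and `Design_frameSignConj`. -/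
theorem bmmByNameFace_of_arch (h13 : U.Fact_alphaLine) (hs : T.Design_frameSignConj)
    (hX : U.BMMByNameArchFace T) : U.BMMByNameFace T := by
  intro F hG hdeg f ι₁ hadm V
  obtain ⟨hI, hR, BD, hBD, hB, hHom, hA, hTL, hLT, hAway, hF, AD, hP, hRd⟩ := hX F hG hdeg f ι₁ hadm V
  exact ⟨hI, hR, BD, hBD, hB, hHom, hA, BD.signMatch_of_arch h13 hBD hA hs AD hP hRd hF hAway, hTL, hLT⟩

/-- KERNEL: the archimedean package implies file 1's by-name package (PerL binders), given M13 and
`Design_frameSignConj`. -/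
theorem bmmByNamePerL_of_arch (h13 : U.Fact_alphaLine) (hs : T.Design_frameSignConj)
    (hX : U.BMMByNameArchPerL T) : U.BMMByNamePerL T := by
  intro K L j hN hK hL φ hφ ι₁ hι₁ t ht V
  obtain ⟨hI, hR, BD, hBD, hB, hHom, hA, hTL, hLT, hAway, hF, AD, hP, hRd⟩ :=
    hX K L j hN hK hL φ hφ ι₁ hι₁ t ht V
  exact ⟨hI, hR, BD, hBD, hB, hHom, hA, BD.signMatch_of_arch h13 hBD hA hs AD hP hRd hF hAway, hTL, hLT⟩

end ThetaModel

variable (U)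

/-- **COR-CM — the lineage's end state, generation 8, archimedean form**: as `COR_CM_of_liu_bmmByName` (file 1)
with the by-name package in the form `BMMByNameArchFace T` — (X4a-i) a kernel theorem, the `ι₁`-half of (X4a-ii)
print BY NAME ([BMM16] p. 66) + one reading + one design seam, and the compact-place half `SignMatchAway` the one
remaining P-IF obstruction. -/
theorem COR_CM_of_liu_bmmByNameArch (M : U.ModelAxioms) (hV : U.Fact_virtualCup11₂) (hL : U.LiuSupplyFace)
    {T : U.ThetaModel} (h₂ : T.Fact_innerEmb) (h₅ : T.Open_thetaSub) (h₇ : T.Open_thetaGen12)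
    (h₈ : T.Open_thetaReal34) (h₉ : T.Open_chars) (h₁₀ : T.Open_occ) (hHR : U.Fact_hodgeRiemann20)
    (hk : T.kappa = SignRecipe.kappa false) (hs : T.Design_frameSignConj)
    {Hk : U.HeckeData} (hD : U.IsoEmbFace Hk T) (hX : U.BMMByNameArchFace T)
    (hPo : U.PohlmannSpan) (hQ : U.Qw8Sufficiency) : U.HC_CM :=
  U.COR_CM_of_liu_bmmByName M hV hL h₂ h₅ h₇ h₈ h₉ h₁₀ hHR hk hs hD
    (ThetaModel.bmmByNameFace_of_arch M.alphaLine hs hX) hPo hQ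

/-- **PerL v5 Thm 4.4 — end state, generation 8, archimedean form.** -/
theorem perL44_of_liu_bmmByNameArch (M : U.ModelAxioms) (hV : U.Fact_virtualCup11₂) (hL : U.LiuSupplyPerL)
    {T : U.ThetaModel} (h₂ : T.Fact_innerEmb) (h₅ : T.Open_thetaSub) (h₇ : T.Open_thetaGen12)
    (h₈ : T.Open_thetaReal34) (h₉ : T.Open_chars) (h₁₀ : T.Open_occ) (hHR : U.Fact_hodgeRiemann20)
    (hk : T.kappa = SignRecipe.kappa false) (hs : T.Design_frameSignConj)
    {Hk : U.HeckeData} (hD : U.IsoEmbPerL Hk T) (hX : U.BMMByNameArchPerL T) : U.PerL44 :=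
  U.perL44_of_liu_bmmByName M hV hL h₂ h₅ h₇ h₈ h₉ h₁₀ hHR hk hs hD
    (ThetaModel.bmmByNamePerL_of_arch M.alphaLine hs hX)

/-- **PerL (`W_per^L`) — end state, generation 8, archimedean form.** -/
theorem perL_of_liu_bmmByNameArch (M : U.ModelAxioms) (hV : U.Fact_virtualCup11₂) (hL : U.LiuSupplyPerL)
    {T : U.ThetaModel} (h₂ : T.Fact_innerEmb) (h₅ : T.Open_thetaSub) (h₇ : T.Open_thetaGen12)
    (h₈ : T.Open_thetaReal34) (h₉ : T.Open_chars) (h₁₀ : T.Open_occ) (hHR : U.Fact_hodgeRiemann20)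
    (hk : T.kappa = SignRecipe.kappa false) (hs : T.Design_frameSignConj)
    {Hk : U.HeckeData} (hD : U.IsoEmbPerL Hk T) (hX : U.BMMByNameArchPerL T) : U.PerL :=
  U.perL_of_liu_bmmByName M hV hL h₂ h₅ h₇ h₈ h₉ h₁₀ hHR hk hs hD
    (ThetaModel.bmmByNamePerL_of_arch M.alphaLine hs hX)

/-! ### Junction with strategy 1 (prl1): the constructed theta model at the frame bit `h = false` -/

/-- **COR-CM over strategy 1's constructed theta model `C.thetaModel false d12 d34`, archimedean by-name route**:
both design inputs of file 1 are theorems (`AdelicThetaCore₀.thetaModel_kappa`, `.design_frameSignConj`); the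
seam `FrameBidegree` reads `BD.a = 1` there (`SignRecipe.frameSign_self`), inside the package. -/
theorem COR_CM_of_liu_bmmByNameArch_adelic (M : U.ModelAxioms) (hV : U.Fact_virtualCup11₂)
    (hL : U.LiuSupplyFace) (C : U.AdelicThetaCore₀) (d12 d34 : ∀ {L : CMField}, SeesawCtx L → SideData L)
    (h₂ : (C.thetaModel false d12 d34).Fact_innerEmb) (h₅ : (C.thetaModel false d12 d34).Open_thetaSub)
    (h₇ : (C.thetaModel false d12 d34).Open_thetaGen12) (h₈ : (C.thetaModel false d12 d34).Open_thetaReal34)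
    (h₉ : (C.thetaModel false d12 d34).Open_chars) (h₁₀ : (C.thetaModel false d12 d34).Open_occ)
    (hHR : U.Fact_hodgeRiemann20) {Hk : U.HeckeData} (hD : U.IsoEmbFace Hk (C.thetaModel false d12 d34))
    (hX : U.BMMByNameArchFace (C.thetaModel false d12 d34)) (hPo : U.PohlmannSpan) (hQ : U.Qw8Sufficiency) :
    U.HC_CM :=
  U.COR_CM_of_liu_bmmByNameArch M hV hL h₂ h₅ h₇ h₈ h₉ h₁₀ hHR (C.thetaModel_kappa false d12 d34)
    (C.design_frameSignConj false d12 d34) hD hX hPo hQ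

/-- **PerL over strategy 1's constructed theta model `C.thetaModel false d12 d34`, archimedean by-name route.** -/
theorem perL_of_liu_bmmByNameArch_adelic (M : U.ModelAxioms) (hV : U.Fact_virtualCup11₂)
    (hL : U.LiuSupplyPerL) (C : U.AdelicThetaCore₀) (d12 d34 : ∀ {L : CMField}, SeesawCtx L → SideData L)
    (h₂ : (C.thetaModel false d12 d34).Fact_innerEmb) (h₅ : (C.thetaModel false d12 d34).Open_thetaSub)
    (h₇ : (C.thetaModel false d12 d34).Open_thetaGen12) (h₈ : (C.thetaModel false d12 d34).Open_thetaReal34)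
    (h₉ : (C.thetaModel false d12 d34).Open_chars) (h₁₀ : (C.thetaModel false d12 d34).Open_occ)
    (hHR : U.Fact_hodgeRiemann20) {Hk : U.HeckeData} (hD : U.IsoEmbPerL Hk (C.thetaModel false d12 d34))
    (hX : U.BMMByNameArchPerL (C.thetaModel false d12 d34)) : U.PerL :=
  U.perL_of_liu_bmmByNameArch M hV hL h₂ h₅ h₇ h₈ h₉ h₁₀ hHR (C.thetaModel_kappa false d12 d34)
    (C.design_frameSignConj false d12 d34) hD hX

end Universe

end HodgeCM
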